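import Summits.CriticalPhenomena.CardyFormulaZ2.Theses.CardyBondTriangular
import Literature.Probability.Percolation.TriChordSides2
import HarnessLib

/-!
# Route CardyBondTriangular · crux `BondTriangularCardy` (stmt-CriticalPhenomena-4664), line `birth`:
# stub `stub_separatesOfIsPath` — blocking by SIMPLE paths of a 4-marked discrete domain

Crux `Summit.CriticalPhenomena.CardyFormulaZ2.Theses.CardyBondTriangular.BondTriangularCardy`, line
`birth`, stub `stub_separatesOfIsPath : Sig.stub_separatesOfIsPath` (the registered signature, whose
text `Sig.stub_separatesOfIsPath` is repeated verbatim below from the line lead's `Sig` file): the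
model-free generalisation of the tree's blocking theorem
`Literature.Probability.Percolation.TriMarkedDomain.separates_of_isChordless` (Bollobás–Riordan,
*Percolation* (2006), Ch. 7, p. 176 and the "easy" direction of (40) p. 201) from CHORDLESS to
SIMPLE paths: a simple path `P` of the 4-marked domain `G` from the arc `A₂` to the arc `A₀`
separates from the stretch `A₁` every face `z` off `P` one of whose vertices is joined to the
marked site `v₃` off `P` — no chain of dual steps of `G` avoiding the bonds of `P` leads from `z`
to a face at `A₁⁺`. Needed by the line because yellow hexagon paths of the Chayes–Lei model are
simple in `𝕋` but may have `𝕋`-chords.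

Proof (pocket excision by parity, all model-free lattice topology of the tree):
* the chordless case does all the work: a shortest walk inside `P.support` from the start to the
  end of `P` is a chordless path `P'` (`exists_isChordless_of_pathIn`), and by
  `separates_of_isChordless` no dual chain avoiding the bonds of `P'` — in particular no dual
  chain avoiding EVERY bond of `𝕋` with both endpoints on `P` — reaches `A₁⁺` from `z`;
* so it suffices to show that a dual chain from `z` to a face at `A₁⁺` avoiding the bonds of `P`
  can be taken to avoid the chords of `P` as well. Take it to be a simple dual path (`bypass` in
  the graph of dual steps). If one of its steps crosses a chord `{P i, P j}` (`i + 2 ≤ j`), close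
  the piece `P i, …, P j` of `P` by the chord into a lattice loop (`IsTriLoop`) and read the
  `ℤ/2` winding labels of `TriFaceLabel.lean` along the dual path: a step changes the label
  exactly when it crosses the chord (the other bonds of the loop are bonds of `P`, never crossed;
  `faceLabel_add_faceLabel_of_adj`, `IsTriLoop.lbond_eq_ite`), the label of `z` is `0` (its
  vertex is joined off `P` to `v₃`, which is adjacent to an outer head:
  `cellLabel_eq_of_pathIn`, `cellLabel_bdryHead_eq_zero`) and so is the label of the final
  face (it has an outer vertex, `faceLabel_eq_zero_of_bdryHead_mem`); hence the chord is
  crossed an even number of times, but the two faces at the chord are the only faces a crossing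
  step can join (`eq_leftFace_or_of_mem_of_mem`), so a simple dual path crosses it at most once —
  i.e. never.

References: B. Bollobás, O. Riordan, *Percolation*, CUP 2006, Ch. 7, p. 176 (separation),
proof of Claim 23 p. 201 and Fig. 24 ((40), blocking) [BollobasRiordan2006].
-/

noncomputable section

namespace Summit.CriticalPhenomena.CardyFormulaZ2.Theorems.BondTriangularCardyLine

open Literature.Probability.Percolation Literature.Probability.LatticeModels Finset

/-! ### The registered signature (verbatim from the lead's `work/Sig.lean`, v4) -/

/-- v4: blocking for SIMPLE (not necessarily chordless) paths of a 4-marked domain from arc 2 to arc 0: a face all of whose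
vertices are off the path and one of whose vertices is joined to the marked site 3 off the path is separated from stretch 1
(the model-free generalisation of `TriMarkedDomain.separates_of_isChordless`; W4's design (B)). (ref: BollobasRiordan2006, Ch. 7 p. 176) -/
def Sig.stub_separatesOfIsPath : Prop :=
  ∀ (D : Literature.Probability.Percolation.TriMarkedDomain 4) (u v : Literature.Probability.LatticeModels.Site 2) (P : Literature.Probability.LatticeModels.triGraph.Walk u v), P.IsPath → u ∈ D.arc 2 → v ∈ D.arc 0 → (∀ x ∈ P.support, x ∈ D.verts) → ∀ (z : Literature.Probability.LatticeModels.HexVertex), Literature.Probability.LatticeModels.hexFaceVertices z ⊆ D.verts → (∀ y ∈ Literature.Probability.LatticeModels.hexFaceVertices z, y ∉ P.support) → (∃ y ∈ Literature.Probability.LatticeModels.hexFaceVertices z, Literature.Probability.Percolation.PathIn Literature.Probability.LatticeModels.triGraph ((D.verts : Set (Literature.Probability.LatticeModels.Site 2)) ∩ {x | x ∉ P.support}) y (D.markSite 3)) → Literature.Probability.Percolation.Separates D.verts {e | e ∈ P.edges} z (D.stretch 1)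

namespace SepPath

/-! ### The graph of dual steps -/

/-- The graph on the faces of `𝕋` whose adjacency is a dual step of `G` avoiding the bonds `B`
(dual steps are symmetric and irreflexive). -/
def dualGraph (G : Finset (Site 2)) (B : Set (Sym2 (Site 2))) : SimpleGraph HexVertex where
  Adj := DualStep G B
  symm := ⟨fun _ _ h => h.symm⟩
  loopless := ⟨fun _ h => h.1.ne rfl⟩

/-- A chain of dual steps is reachability in the graph of dual steps. -/
theorem reachable_of_reflTransGen {G : Finset (Site 2)} {B : Set (Sym2 (Site 2))} {F F' : HexVertex}
    (h : Relation.ReflTransGen (DualStep G B) F F') : (dualGraph G B).Reachable F F' := by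
  induction h with
  | refl => exact SimpleGraph.Reachable.refl _
  | tail _ hst ih => exact ih.trans (SimpleGraph.Adj.reachable (G := dualGraph G B) hst)

/-- A walk in the graph of dual steps all of whose darts satisfy `r` is an `r`-chain. -/
theorem reflTransGen_of_walk {G : Finset (Site 2)} {B : Set (Sym2 (Site 2))} {r : HexVertex → HexVertex → Prop}
    {F F' : HexVertex} (W : (dualGraph G B).Walk F F') (h : ∀ d ∈ W.darts, r d.fst d.snd) :
    Relation.ReflTransGen r F F' := by
  induction W with
  | nil => exact Relation.ReflTransGen.refl
  | @cons a b c hab W' ih =>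
    refine Relation.ReflTransGen.head (h ⟨(a, b), hab⟩ (by simp)) (ih fun d hd => h d ?_)
    rw [SimpleGraph.Walk.darts_cons]
    exact List.mem_cons_of_mem _ hd

/-! ### Parity of the crossings of a closed chain along a walk of faces -/

/-- **Telescoping**: if the labels of the two faces of every dart differ exactly at the darts
satisfying `c`, then the labels of the ends of a walk differ by the number of its darts
satisfying `c`, modulo `2`. -/
theorem faceLabel_add_eq_length_filter {l : List (Site 2)} {G : Finset (Site 2)} {B : Set (Sym2 (Site 2))}
    (c : (dualGraph G B).Dart → Prop) [DecidablePred c]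
    (hp1 : ∀ d : (dualGraph G B).Dart, c d → faceLabel (cycDarts l) d.fst + faceLabel (cycDarts l) d.snd = 1)
    (hp0 : ∀ d : (dualGraph G B).Dart, ¬ c d → faceLabel (cycDarts l) d.fst + faceLabel (cycDarts l) d.snd = 0)
    {F F' : HexVertex} (W : (dualGraph G B).Walk F F') :
    faceLabel (cycDarts l) F + faceLabel (cycDarts l) F' = ((W.darts.filter fun d => decide (c d)).length : ZMod 2) := by
  have self : ∀ x : ZMod 2, x + x = 0 := by decide
  induction W with
  | nil => simp [self]
  | @cons a b e hab W' ih =>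
    rw [SimpleGraph.Walk.darts_cons, List.filter_cons]
    have key : ∀ x y w : ZMod 2, x + w = (x + y) + (y + w) := by decide
    by_cases h : c ⟨(a, b), hab⟩
    · have h1 : faceLabel (cycDarts l) a + faceLabel (cycDarts l) b = 1 := hp1 _ h
      rw [if_pos (decide_eq_true h), List.length_cons, Nat.cast_succ,
        key (faceLabel (cycDarts l) a) (faceLabel (cycDarts l) b), h1, ih, add_comm]
    · have h0 : faceLabel (cycDarts l) a + faceLabel (cycDarts l) b = 0 := hp0 _ h
      rw [if_neg (by simp [h]), key (faceLabel (cycDarts l) a) (faceLabel (cycDarts l) b), h0, ih, zero_add]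

/-- A duplicate-free list all of whose entries are equal has at most one entry. -/
theorem length_le_one_of_nodup {α : Type*} : ∀ {l : List α}, l.Nodup → ∀ {e : α}, (∀ x ∈ l, x = e) → l.length ≤ 1
  | [], _, _, _ => by simp
  | [_], _, _, _ => by simp
  | x :: y :: t, hl, e, he => by
    exfalso
    rw [List.nodup_cons] at hl
    refine hl.1 ?_
    rw [he x (by simp), ← he y (by simp)]
    exact List.mem_cons_self

/-- **The two faces at a bond**: a dart of the graph of dual steps whose common side contains the
adjacent sites `a, b` joins the two faces at the bond `{a, b}`; its edge is determined. -/
theorem dart_edge_eq_of_mem_of_mem {G : Finset (Site 2)} {B : Set (Sym2 (Site 2))} (d : (dualGraph G B).Dart)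
    {a b : Site 2} (hab : triGraph.Adj a b) (ha : a ∈ faceEdge d.fst d.snd) (hb : b ∈ faceEdge d.fst d.snd) :
    d.edge = s(leftFace a b, leftFace b a) := by
  rw [faceEdge, Finset.mem_inter] at ha hb
  have hne : d.fst ≠ d.snd := d.adj.1.ne
  have he : d.edge = s(d.fst, d.snd) := rfl
  rw [he]
  rcases eq_leftFace_or_of_mem_of_mem hab ha.1 hb.1 with h1 | h1 <;>
    rcases eq_leftFace_or_of_mem_of_mem hab ha.2 hb.2 with h2 | h2
  · exact absurd (h1.trans h2.symm) hne
  · rw [h1, h2]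
  · rw [h1, h2, Sym2.eq_swap]
  · exact absurd (h1.trans h2.symm) hne

/-! ### The loop cut off by a chord -/

/-- The closed darts of a nonempty list: its darts and the closing dart. -/
theorem cycDarts_eq_append {l : List (Site 2)} (hl : l ≠ []) :
    cycDarts l = pathDarts l ++ [(l.getLast hl, l.head hl)] := by
  match l, hl with
  | x :: t, _ =>
    show pathDarts (x :: t ++ [x]) = _
    rw [pathDarts_append_singleton (List.cons_ne_nil x t)]
    rfl

variable {u v : Site 2}

/-- Consecutive vertices of a walk span one of its bonds. -/
theorem sym2_getVert_succ_mem_edges (P : triGraph.Walk u v) {n : ℕ} (hn : n < P.length) :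
    s(P.getVert n, P.getVert (n + 1)) ∈ P.edges := by
  have hnil : ¬ (P.drop n).Nil := by rw [SimpleGraph.Walk.nil_drop_iff]; omega
  have hmem := SimpleGraph.Walk.mk_start_snd_mem_edges hnil
  rw [SimpleGraph.Walk.snd, SimpleGraph.Walk.drop_getVert, SimpleGraph.Walk.edges_drop] at hmem
  exact List.mem_of_mem_drop hmem

/-- The sites of the walk `P` from position `i` to position `j`. -/
def seg (P : triGraph.Walk u v) (i j : ℕ) : List (Site 2) := (P.support.drop i).take (j - i + 1)

/-- The segment has `j - i + 1` sites. -/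
theorem length_seg (P : triGraph.Walk u v) {i j : ℕ} (hij : i ≤ j) (hj : j ≤ P.length) :
    (seg P i j).length = j - i + 1 := by
  unfold seg; rw [List.length_take, List.length_drop, SimpleGraph.Walk.length_support]; omega

/-- The segment is nonempty. -/
theorem seg_ne_nil (P : triGraph.Walk u v) {i j : ℕ} (hij : i ≤ j) (hj : j ≤ P.length) : seg P i j ≠ [] :=
  List.ne_nil_of_length_pos (by rw [length_seg P hij hj]; omega)

/-- The `t`-th site of the segment is the `(i + t)`-th vertex of the walk. -/
theorem getElem_seg (P : triGraph.Walk u v) {i j t : ℕ} (ht : t < (seg P i j).length) : (seg P i j)[t] = P.getVert (i + t) := by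
  simp only [seg, List.getElem_take, List.getElem_drop, SimpleGraph.Walk.support_getElem_eq_getVert]

/-- The segment starts at the `i`-th vertex … -/
theorem head_seg (P : triGraph.Walk u v) {i j : ℕ} (hij : i ≤ j) (hj : j ≤ P.length) :
    (seg P i j).head (seg_ne_nil P hij hj) = P.getVert i := by
  rw [List.head_eq_getElem, getElem_seg P]; rfl

/-- … and ends at the `j`-th vertex. -/
theorem getLast_seg (P : triGraph.Walk u v) {i j : ℕ} (hij : i ≤ j) (hj : j ≤ P.length) :
    (seg P i j).getLast (seg_ne_nil P hij hj) = P.getVert j := by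
  rw [List.getLast_eq_getElem, getElem_seg P, length_seg P hij hj]
  congr 1; omega

/-- The segment is a sublist of the support. -/
theorem seg_sublist (P : triGraph.Walk u v) (i j : ℕ) : (seg P i j).Sublist P.support :=
  (List.take_sublist _ _).trans (List.drop_sublist _ _)

/-- The darts of the segment are bonds of the walk. -/
theorem sym2_mem_edges_of_mem_pathDarts_seg (P : triGraph.Walk u v) {i j : ℕ} (hij : i ≤ j) (hj : j ≤ P.length)
    {d : Site 2 × Site 2} (hd : d ∈ pathDarts (seg P i j)) : s(d.1, d.2) ∈ P.edges := by
  obtain ⟨n, hn, rfl⟩ := List.mem_iff_getElem.1 hd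
  have hlen := length_seg P hij hj
  have hn' : n < j - i := by rw [length_pathDarts, hlen] at hn; omega
  rw [getElem_pathDarts, getElem_seg P, getElem_seg P,
    show i + (n + 1) = i + n + 1 by omega]
  exact sym2_getVert_succ_mem_edges P (by omega)

/-- **The loop of a chord**: the segment of a simple walk between the endpoints `P i`, `P j`
(`i + 2 ≤ j`) of a chord, closed by the chord, is a lattice loop. -/
theorem isTriLoop_seg (P : triGraph.Walk u v) (hP : P.IsPath) {i j : ℕ} (hij : i + 2 ≤ j) (hj : j ≤ P.length)
    (hab : triGraph.Adj (P.getVert i) (P.getVert j)) : IsTriLoop (seg P i j) := by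
  refine ⟨(seg_sublist P i j).nodup hP.support_nodup, by rw [length_seg P (by omega) hj]; omega, ?_⟩
  refine adj_cycDarts_of_isChain (seg_ne_nil P (by omega) hj) ((P.isChain_adj_support.drop i).take _) ?_
  rw [getLast_seg P (by omega) hj, head_seg P (by omega) hj]
  exact hab.symm

/-- The closing dart of the loop of a chord is the chord, backwards. -/
theorem chord_mem_cycDarts_seg (P : triGraph.Walk u v) {i j : ℕ} (hij : i ≤ j) (hj : j ≤ P.length) :
    (P.getVert j, P.getVert i) ∈ cycDarts (seg P i j) := by
  rw [cycDarts_eq_append (seg_ne_nil P hij hj), getLast_seg P hij hj, head_seg P hij hj]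
  simp

/-- A closed dart of the loop of a chord is a bond of the walk or the closing chord. -/
theorem mem_cycDarts_seg (P : triGraph.Walk u v) {i j : ℕ} (hij : i ≤ j) (hj : j ≤ P.length)
    {d : Site 2 × Site 2} (hd : d ∈ cycDarts (seg P i j)) :
    s(d.1, d.2) ∈ P.edges ∨ d = (P.getVert j, P.getVert i) := by
  rw [cycDarts_eq_append (seg_ne_nil P hij hj), List.mem_append, List.mem_singleton, getLast_seg P hij hj,
    head_seg P hij hj] at hd
  rcases hd with hd | hd
  · exact Or.inl (sym2_mem_edges_of_mem_pathDarts_seg P hij hj hd)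
  · exact Or.inr hd

/-- The endpoints of the closed darts of the loop of a chord are vertices of the walk. -/
theorem mem_support_of_mem_cycDarts_seg (P : triGraph.Walk u v) {i j : ℕ} {d : Site 2 × Site 2}
    (hd : d ∈ cycDarts (seg P i j)) : d.1 ∈ P.support ∧ d.2 ∈ P.support :=
  ⟨(seg_sublist P i j).subset (mem_of_mem_cycDarts hd).1, (seg_sublist P i j).subset (mem_of_mem_cycDarts hd).2⟩

/-! ### The label rule along dual steps avoiding the bonds of the walk -/

/-- **Crossing the chord flips the label, nothing else does**: for a dart of the graph of dual
steps of `G` avoiding the bonds of `P`, the labels (with respect to the loop of the chord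
`{P i, P j}`) of its two faces differ exactly when its common side is the chord. -/
theorem faceLabel_add_faceLabel_dart {G : Finset (Site 2)} (P : triGraph.Walk u v) (hP : P.IsPath) {i j : ℕ}
    (hij : i + 2 ≤ j) (hj : j ≤ P.length) (hab : triGraph.Adj (P.getVert i) (P.getVert j))
    (d : (dualGraph G {e | e ∈ P.edges}).Dart) :
    (P.getVert i ∈ faceEdge d.fst d.snd ∧ P.getVert j ∈ faceEdge d.fst d.snd →
      faceLabel (cycDarts (seg P i j)) d.fst + faceLabel (cycDarts (seg P i j)) d.snd = 1) ∧
    (¬ (P.getVert i ∈ faceEdge d.fst d.snd ∧ P.getVert j ∈ faceEdge d.fst d.snd) →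
      faceLabel (cycDarts (seg P i j)) d.fst + faceLabel (cycDarts (seg P i j)) d.snd = 0) := by
  have hL := isTriLoop_seg P hP hij hj hab
  obtain ⟨hadj', -, hB⟩ := d.adj
  obtain ⟨x, y, hxy, hfe⟩ := exists_faceEdge_eq_pair hadj'
  rw [faceLabel_add_faceLabel_of_adj hL.adj hadj' hfe, hL.lbond_eq_ite, hfe]
  have hxyB : s(x, y) ∉ P.edges := hB x y hfe
  simp only [Finset.mem_insert, Finset.mem_singleton]
  refine ⟨fun hc => ?_, fun hc => ?_⟩
  · rw [if_pos]
    refine ⟨(P.getVert j, P.getVert i), chord_mem_cycDarts_seg P (by omega) hj, ?_⟩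
    have hne : P.getVert i ≠ P.getVert j := hab.ne
    rcases hc.1 with h1 | h1 <;> rcases hc.2 with h2 | h2
    · exact absurd (h1.trans h2.symm) hne
    · rw [← h1, ← h2, Sym2.eq_swap]
    · rw [← h1, ← h2]
    · exact absurd (h1.trans h2.symm) hne
  · rw [if_neg]
    rintro ⟨e, he, hexy⟩
    rcases mem_cycDarts_seg P (by omega) hj he with h | rfl
    · exact hxyB (hexy ▸ h)
    · apply hc
      have ha : P.getVert i ∈ s(x, y) := by rw [hexy]; exact Sym2.mem_mk_right _ _
      have hb : P.getVert j ∈ s(x, y) := by rw [hexy]; exact Sym2.mem_mk_left _ _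
      exact ⟨Sym2.mem_iff.1 ha, Sym2.mem_iff.1 hb⟩

/-! ### No simple dual path avoiding the bonds of `P` crosses a chord of `P` -/

/-- **Pocket excision.** In a 4-marked domain, let `P` be a simple walk of sites of the domain with
a chord `{P i, P j}` (`i + 2 ≤ j`), `z` a face off `P` with a vertex joined off `P` to the marked
site `v₃`, and `F` a face containing a dart of the stretch `A₁`. Then no dart of a simple path
from `z` to `F` in the graph of dual steps avoiding the bonds of `P` crosses the chord: the labels
of `z` and `F` with respect to the loop of the chord both vanish, the label flips exactly at the
crossings of the chord, and all crossing darts carry the same edge. -/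
theorem not_cross (D : TriMarkedDomain 4) (P : triGraph.Walk u v) (hP : P.IsPath) (hsupp : ∀ x ∈ P.support, x ∈ D.verts)
    {i j : ℕ} (hij : i + 2 ≤ j) (hj : j ≤ P.length) (hab : triGraph.Adj (P.getVert i) (P.getVert j))
    {z : HexVertex} (hzP : ∀ y ∈ hexFaceVertices z, y ∉ P.support)
    (hloc : ∃ y ∈ hexFaceVertices z, PathIn triGraph ((D.verts : Set (Site 2)) ∩ {x | x ∉ P.support}) y (D.markSite 3))
    {F : HexVertex} (hF : ∃ d ∈ D.stretch 1, d.1 ∈ hexFaceVertices F ∧ d.2 ∈ hexFaceVertices F)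
    (W : (dualGraph D.verts {e | e ∈ P.edges}).Walk z F) (hW : W.IsPath) :
    ∀ d ∈ W.darts, ¬ (P.getVert i ∈ faceEdge d.fst d.snd ∧ P.getVert j ∈ faceEdge d.fst d.snd) := by
  have hL := isTriLoop_seg P hP hij hj hab
  have hCG : ∀ e ∈ cycDarts (seg P i j), e.1 ∈ D.verts ∧ e.2 ∈ D.verts := fun e he =>
    ⟨hsupp _ (mem_support_of_mem_cycDarts_seg P he).1, hsupp _ (mem_support_of_mem_cycDarts_seg P he).2⟩
  have hoff : ∀ w, w ∉ P.support → ∀ e ∈ cycDarts (seg P i j), e.1 ≠ w ∧ e.2 ≠ w := fun w hw e he =>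
    ⟨fun h => hw (h ▸ (mem_support_of_mem_cycDarts_seg P he).1),
      fun h => hw (h ▸ (mem_support_of_mem_cycDarts_seg P he).2)⟩
  -- the label of `z` vanishes
  have hz0 : faceLabel (cycDarts (seg P i j)) z = 0 := by
    obtain ⟨y, hy, hpath⟩ := hloc
    have hadj3 : triGraph.Adj (D.markSite 3) (D.bdryHead (D.pos 3)) := D.adj_fst_bdryHead (D.pos 3)
    rw [faceLabel_eq_cellLabel_of_mem hL.adj (hoff y (hzP y hy)) hy,
      cellLabel_eq_of_pathIn hL.adj (A := (D.verts : Set (Site 2)) ∩ {x | x ∉ P.support}) (fun w hw => hoff w hw.2) hpath,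
      cellLabel_eq_of_adj hL.adj hadj3 (hoff _ hpath.right_mem.2) (hoff _ fun h => D.bdryHead_not_mem _ (hsupp _ h))]
    exact D.cellLabel_bdryHead_eq_zero hL.adj hCG (D.pos 3)
  -- the label of `F` vanishes
  have hF0 : faceLabel (cycDarts (seg P i j)) F = 0 := by
    obtain ⟨d₁, hd₁, -, hd₁F⟩ := hF
    obtain ⟨n, -, hn⟩ := D.cycle d₁ (D.mem_triBdryDarts_of_mem_stretch hd₁)
    refine D.faceLabel_eq_zero_of_bdryHead_mem hL.adj hCG (n := n) ?_
    have e : D.bdryHead n = d₁.2 := by unfold TriMarkedDomain.bdryHead; rw [hn]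
    rw [e]; exact hd₁F
  -- telescoping: the number of crossings is even …
  set c : (dualGraph D.verts {e | e ∈ P.edges}).Dart → Prop := fun d =>
    P.getVert i ∈ faceEdge d.fst d.snd ∧ P.getVert j ∈ faceEdge d.fst d.snd with hc
  have htel := faceLabel_add_eq_length_filter c (fun d hd => (faceLabel_add_faceLabel_dart P hP hij hj hab d).1 hd)
    (fun d hd => (faceLabel_add_faceLabel_dart P hP hij hj hab d).2 hd) W
  rw [hz0, hF0] at htel
  -- … and at most one, all crossing darts having the same edge
  have hle : (W.darts.filter fun d => decide (c d)).length ≤ 1 := by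
    have hsub : ((W.darts.filter fun d => decide (c d)).map SimpleGraph.Dart.edge).Sublist
        (W.darts.map SimpleGraph.Dart.edge) := List.filter_sublist.map _
    have hnd : ((W.darts.filter fun d => decide (c d)).map SimpleGraph.Dart.edge).Nodup :=
      hsub.nodup hW.isTrail.edges_nodup
    have := length_le_one_of_nodup hnd
      (e := s(leftFace (P.getVert i) (P.getVert j), leftFace (P.getVert j) (P.getVert i))) fun x hx => by
        obtain ⟨d, hd, rfl⟩ := List.mem_map.1 hx
        have hcd : c d := of_decide_eq_true (List.mem_filter.1 hd).2
        exact dart_edge_eq_of_mem_of_mem d hab hcd.1 hcd.2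
    rwa [List.length_map] at this
  have hlen0 : (W.darts.filter fun d => decide (c d)).length = 0 := by
    generalize hN : (W.darts.filter fun d => decide (c d)).length = N at hle htel
    interval_cases N
    · rfl
    · exact absurd htel (by decide)
  intro d hd hcd
  have hmem : d ∈ W.darts.filter fun d => decide (c d) := List.mem_filter.2 ⟨hd, decide_eq_true hcd⟩
  rw [List.length_eq_zero_iff.1 hlen0] at hmem
  simp at hmem

end SepPath

open SepPath in
/-- **Blocking by simple paths** (the registered stub, BY NAME): a simple `A₂ → A₀` path of a
4-marked domain, avoiding the face `z` one of whose vertices is joined to the marked site `v₃`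
off the path, separates `z` from the stretch `A₁`. The chordless case is the tree's
`TriMarkedDomain.separates_of_isChordless`, applied to a chordless path inside the support of
`P` with the same ends (`exists_isChordless_of_pathIn`), which blocks every dual chain avoiding
all bonds with both endpoints on `P`; and a dual chain avoiding the bonds of `P`, made simple,
avoids the chords of `P` too (`SepPath.not_cross`). -/
theorem stub_separatesOfIsPath : Sig.stub_separatesOfIsPath := by
  classical
  intro D u v P hP hu hv hsupp z hz hzP hloc F hF hchain
  -- (1) the chordless case blocks every dual chain avoiding all bonds spanned by `P`
  have hsep : Separates D.verts {e | ∃ a b : Site 2, e = s(a, b) ∧ a ∈ P.support ∧ b ∈ P.support} z (D.stretch 1) := by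
    obtain ⟨a, ha, b, hb, P', -, hch, hS⟩ := exists_isChordless_of_pathIn (H := triGraph)
      (S := {x | x ∈ P.support}) (A := {u}) (B := {v}) ⟨u, rfl, v, rfl, PathIn.of_walk P fun x hx => hx⟩
    rw [Set.mem_singleton_iff] at ha hb
    subst ha; subst hb
    intro F' hF' hch'
    refine D.separates_of_isChordless P' hch hu hv (fun x hx => hsupp x (hS x hx)) hz
      (fun y hy hyP => hzP y hy (hS y hyP)) ?_ F' hF' (hch'.lift id fun F₁ F₂ h => ?_)
    · obtain ⟨y, hy, hpath⟩ := hloc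
      exact ⟨y, hy, hpath.mono (Set.inter_subset_inter_right _
        fun x (hx : x ∉ P.support) (hxP : x ∈ P'.support) => hx (hS x hxP))⟩
    · exact ⟨h.1, h.2.1, fun x y hxy hmem => h.2.2 x y hxy ⟨x, y, rfl, hS x (P'.fst_mem_support_of_mem_edges hmem),
        hS y (P'.snd_mem_support_of_mem_edges hmem)⟩⟩
  -- (2) a simple dual path avoiding the bonds of `P` avoids the chords of `P`
  obtain ⟨W₀⟩ := reachable_of_reflTransGen hchain
  have hW : W₀.bypass.IsPath := W₀.bypass_isPath
  refine hsep F hF (reflTransGen_of_walk W₀.bypass fun d hd => ?_)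
  obtain ⟨hadj', hsub, hB⟩ := d.adj
  refine ⟨hadj', hsub, fun x y hxy hmem => ?_⟩
  obtain ⟨a, b, hexy, ha, hb⟩ := hmem
  have hxP : x ∈ P.support := by
    have : x ∈ s(a, b) := by rw [← hexy]; exact Sym2.mem_mk_left _ _
    rcases Sym2.mem_iff.1 this with rfl | rfl <;> assumption
  have hyP : y ∈ P.support := by
    have : y ∈ s(a, b) := by rw [← hexy]; exact Sym2.mem_mk_right _ _
    rcases Sym2.mem_iff.1 this with rfl | rfl <;> assumption
  obtain ⟨x', y', hne', hfe'⟩ := exists_faceEdge_eq_pair hadj'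
  have hx_fe : x ∈ faceEdge d.fst d.snd := by rw [hxy]; simp
  have hy_fe : y ∈ faceEdge d.fst d.snd := by rw [hxy]; simp
  have hxy_ne : x ≠ y := by
    rintro rfl
    have h1 : x' ∈ ({x, x} : Finset (Site 2)) := by rw [← hxy, hfe']; simp
    have h2 : y' ∈ ({x, x} : Finset (Site 2)) := by rw [← hxy, hfe']; simp
    simp only [Finset.mem_insert, Finset.mem_singleton, or_self] at h1 h2
    exact hne' (h1.trans h2.symm)
  have hadj_xy : triGraph.Adj x y := by
    rw [faceEdge, Finset.mem_inter] at hx_fe hy_fe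
    exact Literature.Probability.Percolation.adj_of_mem_hexFaceVertices hx_fe.1 hy_fe.1 hxy_ne
  have hnotP : s(x, y) ∉ P.edges := hB x y hxy
  obtain ⟨m, rfl, hm⟩ := SimpleGraph.Walk.mem_support_iff_exists_getVert.1 hxP
  obtain ⟨n, rfl, hn⟩ := SimpleGraph.Walk.mem_support_iff_exists_getVert.1 hyP
  have hmn : m ≠ n := fun e => hxy_ne (by rw [e])
  have hm1 : n ≠ m + 1 := fun e => hnotP (by rw [e]; exact sym2_getVert_succ_mem_edges P (by omega))
  have hn1 : m ≠ n + 1 := fun e => hnotP (by rw [e, Sym2.eq_swap]; exact sym2_getVert_succ_mem_edges P (by omega))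
  rcases lt_or_gt_of_ne hmn with hlt | hlt
  · exact not_cross D P hP hsupp (i := m) (j := n) (by omega) hn hadj_xy hzP hloc hF W₀.bypass hW d hd ⟨hx_fe, hy_fe⟩
  · exact not_cross D P hP hsupp (i := n) (j := m) (by omega) hm hadj_xy.symm hzP hloc hF W₀.bypass hW d hd
      ⟨hy_fe, hx_fe⟩

end Summit.CriticalPhenomena.CardyFormulaZ2.Theorems.BondTriangularCardyLine

end
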